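import Mathlib.RingTheory.Multiplicity
import Mathlib.Algebra.Polynomial.RingDivision
import Mathlib.Algebra.MvPolynomial.NoZeroDivisors
import Literature.NumberTheory.DiophantineGeometry.PlaneCurveBezoutWeak
import HarnessLib

/-!
# Irreducibility of a plane section from a truncated root with no small annihilator

The concluding step of Kaltofen's effective Hilbert irreducibility theorem in Cafure–Matera's
form (2006, proof of Thm. 3.3: "the specialized system (8) has no solutions …, which implies that
`χ(X, Y, γ)` has no irreducible factors … of degree at most `D`"), for a single field `k`:

let `χ₀ ∈ k[Y][X]` (outer variable `X`, inner `Y`) have `X`-degree `δ ≥ 1`, nonzero constant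
leading coefficient, and total degree `δ`; let `a₀ ∈ k[Y]` be a root to precision `Y^{2κ}`
(`Y^{2κ} ∣ χ₀(a₀)`); suppose no nonzero `P ∈ k[Y][X]` with `deg_X P ≤ δ - 1` and coefficients of
`Y`-degree `≤ δ - 1` has `Y^κ ∣ P(a₀)`. Then `χ₀` is irreducible
(`irreducible_of_noSmallAnnihilator`): a factorisation `χ₀ = P Q` with both factors of positive
`X`-degree has total degrees adding up to `δ`, so both factors are "small", and one of them
vanishes on `a₀` to precision `Y^κ` since `Y^{2κ} ∣ P(a₀) Q(a₀)`.

Total degree on `k[Y][X]` is read through `Polynomial.Bivariate.equivMvPolynomial`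
(`coeff_coeff_eq_zero_of_totalDegree_lt` from `PlaneCurveBezoutWeak`, and the converse
`totalDegree_equivMvPolynomial_le` proved here), so that its additivity is Mathlib's
`MvPolynomial.totalDegree_mul_of_isDomain`.

## References

* E. Kaltofen, J. Comput. System Sci. 50 (1995) 274–295, §3, proof of Thm. 5. [Kaltofen1995]
* A. Cafure, G. Matera, Finite Fields Appl. 12 (2006) 155–185, proof of Thm. 3.3. [CafureMatera2006]
-/

noncomputable section

open scoped Classical Polynomial.Bivariate
open Polynomial

namespace Literature.NumberTheory.DiophantineGeometry

universe u

variable {k : Type u} [Field k]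

/-! ### Total degree of bivariate polynomials through `equivMvPolynomial` -/

/-- Every exponent vector on `Fin 2` is `(d 0, d 1)`. [folklore] -/
theorem finsupp_fin_two_eq (d : Fin 2 →₀ ℕ) :
    d = Finsupp.single 0 (d 0) + Finsupp.single 1 (d 1) := by
  ext i
  fin_cases i <;> simp

/-- If all coefficients of `Xʲ Yⁿ` with `j + n > e` vanish then the total degree is `≤ e`.
[folklore] -/
theorem totalDegree_equivMvPolynomial_le (P : k[X][Y]) {e : ℕ}
    (h : ∀ n m, e < m + n → (P.coeff n).coeff m = 0) :
    (Bivariate.equivMvPolynomial k P).totalDegree ≤ e := by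
  rw [MvPolynomial.totalDegree]
  refine Finset.sup_le fun d hd ↦ ?_
  rw [MvPolynomial.mem_support_iff] at hd
  by_contra hlt
  rw [not_le] at hlt
  apply hd
  rw [finsupp_fin_two_eq d, Dioph.coeff_equivMvPolynomial]
  refine h _ _ ?_
  have : (d.sum fun _ e ↦ e) = d 0 + d 1 := by
    conv_lhs => rw [finsupp_fin_two_eq d]
    rw [Dioph.sum_single_add_single]
  omega

/-- The total degree bounds the outer degree: if `P.coeff n ≠ 0` then `n ≤ totalDegree`. [folklore] -/
theorem le_totalDegree_equivMvPolynomial_of_coeff_ne_zero (P : k[X][Y]) {n : ℕ} (hn : P.coeff n ≠ 0) :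
    n ≤ (Bivariate.equivMvPolynomial k P).totalDegree := by
  by_contra hlt
  rw [not_le] at hlt
  apply hn
  ext m
  rw [coeff_zero]
  have := Dioph.coeff_coeff_symm_eq_zero (Bivariate.equivMvPolynomial k P) (m := m) (n := n) (by omega)
  rwa [AlgEquiv.symm_apply_apply] at this

/-- The total degree bounds the `X`-degree of each coefficient. [folklore] -/
theorem natDegree_coeff_le_totalDegree_sub (P : k[X][Y]) (n : ℕ) :
    (P.coeff n).natDegree ≤ (Bivariate.equivMvPolynomial k P).totalDegree - n := by
  rw [natDegree_le_iff_coeff_eq_zero]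
  intro m hm
  have := Dioph.coeff_coeff_symm_eq_zero (Bivariate.equivMvPolynomial k P) (m := m) (n := n) (by omega)
  rwa [AlgEquiv.symm_apply_apply] at this

/-! ### Prime powers dividing a product -/

/-- If `Y^{2κ}` divides a product in `k[Y]` then `Y^κ` divides a factor. [folklore] -/
theorem X_pow_dvd_or_of_X_pow_two_mul_dvd_mul {A B : k[X]} {κ : ℕ}
    (h : (X : k[X]) ^ (2 * κ) ∣ A * B) : (X : k[X]) ^ κ ∣ A ∨ (X : k[X]) ^ κ ∣ B := by
  by_cases hA : A = 0
  · left; rw [hA]; exact dvd_zero _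
  by_cases hB : B = 0
  · right; rw [hB]; exact dvd_zero _
  have hp : Prime (X : k[X]) := prime_X
  have hle := le_emultiplicity_of_pow_dvd h
  rw [emultiplicity_mul hp] at hle
  have hfA := (finiteMultiplicity_iff_emultiplicity_ne_top.1
    (FiniteMultiplicity.of_prime_left hp hA))
  have hfB := (finiteMultiplicity_iff_emultiplicity_ne_top.1
    (FiniteMultiplicity.of_prime_left hp hB))
  obtain ⟨mA, hmA⟩ := ENat.ne_top_iff_exists.1 hfA
  obtain ⟨mB, hmB⟩ := ENat.ne_top_iff_exists.1 hfB
  rw [← hmA, ← hmB, ← ENat.coe_add, ENat.coe_le_coe] at hle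
  rcases le_or_gt κ mA with hκ | hκ
  · left
    exact pow_dvd_of_le_emultiplicity (by rw [← hmA]; exact_mod_cast hκ)
  · right
    exact pow_dvd_of_le_emultiplicity (by rw [← hmB]; exact_mod_cast (by omega : κ ≤ mB))

/-! ### The irreducibility criterion -/

/-- **Irreducibility from a truncated root with no small annihilator** (Kaltofen; Cafure–Matera,
proof of Thm. 3.3). Let `χ₀ ∈ k[Y][X]` have `deg_X χ₀ = δ ≥ 1`, leading coefficient a nonzero
constant, and total degree `≤ δ`; let `a₀ ∈ k[Y]` with `Y^{2κ} ∣ χ₀(a₀)`; assume every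
`P ∈ k[Y][X]` with `deg_X P ≤ δ - 1`, coefficients of `Y`-degree `≤ δ - 1` and `Y^κ ∣ P(a₀)`
vanishes. Then `χ₀` is irreducible. [cite: Kaltofen1995, §3, proof of Thm. 5]
[cite: CafureMatera2006, proof of Thm. 3.3] -/
theorem irreducible_of_noSmallAnnihilator {χ₀ : k[X][Y]} {δ κ : ℕ} (hδ : 1 ≤ δ)
    (hdeg : χ₀.natDegree = δ) {c : k} (hc : c ≠ 0) (hlead : χ₀.leadingCoeff = C c)
    (htd : ∀ n m, δ < m + n → (χ₀.coeff n).coeff m = 0)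
    {a₀ : k[X]} (hroot : (X : k[X]) ^ (2 * κ) ∣ χ₀.eval a₀)
    (hinj : ∀ P : k[X][Y], P.natDegree ≤ δ - 1 → (∀ n, (P.coeff n).natDegree ≤ δ - 1) →
      (X : k[X]) ^ κ ∣ P.eval a₀ → P = 0) :
    Irreducible χ₀ := by
  have hχ0 : χ₀ ≠ 0 := fun h ↦ by rw [h, natDegree_zero] at hdeg; omega
  -- total degree of `χ₀` is exactly `δ`
  set T := fun P : k[X][Y] ↦ (Bivariate.equivMvPolynomial k P).totalDegree with hT
  have hTχ : T χ₀ = δ := by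
    refine le_antisymm (totalDegree_equivMvPolynomial_le χ₀ htd) ?_
    refine le_totalDegree_equivMvPolynomial_of_coeff_ne_zero χ₀ ?_
    rw [← hdeg, coeff_natDegree, hlead]
    exact C_ne_zero.2 hc
  refine ⟨fun hu ↦ ?_, fun P Q hPQ ↦ ?_⟩
  · -- not a unit: degree `δ ≥ 1`
    have := natDegree_eq_zero_of_isUnit hu
    omega
  have hP0 : P ≠ 0 := fun h ↦ hχ0 (by rw [hPQ, h, zero_mul])
  have hQ0 : Q ≠ 0 := fun h ↦ hχ0 (by rw [hPQ, h, mul_zero])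
  -- leading coefficients are units (constants)
  have hlc : P.leadingCoeff * Q.leadingCoeff = C c := by rw [← leadingCoeff_mul, ← hPQ, hlead]
  have hPu : IsUnit P.leadingCoeff := isUnit_iff_exists_inv.2 ⟨Q.leadingCoeff * C c⁻¹, by
    rw [← mul_assoc, hlc, ← C_mul, mul_inv_cancel₀ hc, C_1]⟩
  have hQu : IsUnit Q.leadingCoeff := isUnit_iff_exists_inv.2 ⟨P.leadingCoeff * C c⁻¹, by
    rw [← mul_assoc, mul_comm Q.leadingCoeff, hlc, ← C_mul, mul_inv_cancel₀ hc, C_1]⟩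
  -- a factor of `X`-degree `0` is a unit
  have hdegPQ : P.natDegree + Q.natDegree = δ := by rw [← natDegree_mul hP0 hQ0, ← hPQ, hdeg]
  by_cases hP1 : P.natDegree = 0
  · left
    rw [eq_C_of_natDegree_eq_zero hP1]
    refine isUnit_C.2 ?_
    have : P.leadingCoeff = P.coeff 0 := by rw [leadingCoeff, hP1]
    rwa [← this]
  by_cases hQ1 : Q.natDegree = 0
  · right
    rw [eq_C_of_natDegree_eq_zero hQ1]
    refine isUnit_C.2 ?_
    have : Q.leadingCoeff = Q.coeff 0 := by rw [leadingCoeff, hQ1]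
    rwa [← this]
  -- both factors have positive `X`-degree: derive a contradiction
  exfalso
  have hTadd : T P + T Q = δ := by
    rw [← hTχ, hT]
    simp only
    rw [hPQ, map_mul, MvPolynomial.totalDegree_mul_of_isDomain]
    · exact (EmbeddingLike.map_ne_zero_iff).2 hP0
    · exact (EmbeddingLike.map_ne_zero_iff).2 hQ0
  have hTP1 : 1 ≤ T P := (Nat.one_le_iff_ne_zero.2 hP1).trans
    (le_totalDegree_equivMvPolynomial_of_coeff_ne_zero P
      (by rw [coeff_natDegree]; exact leadingCoeff_ne_zero.2 hP0))
  have hTQ1 : 1 ≤ T Q := (Nat.one_le_iff_ne_zero.2 hQ1).trans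
    (le_totalDegree_equivMvPolynomial_of_coeff_ne_zero Q
      (by rw [coeff_natDegree]; exact leadingCoeff_ne_zero.2 hQ0))
  -- both factors are "small"
  have hsmall : ∀ {S : k[X][Y]}, S ≠ 0 → T S ≤ δ - 1 → S.natDegree ≤ δ - 1 ∧
      ∀ n, (S.coeff n).natDegree ≤ δ - 1 := by
    intro S hS0 hTS
    have hTS' : (Bivariate.equivMvPolynomial k S).totalDegree ≤ δ - 1 := hTS
    refine ⟨?_, fun n ↦ ?_⟩
    · exact (le_totalDegree_equivMvPolynomial_of_coeff_ne_zero S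
        (by rw [coeff_natDegree]; exact leadingCoeff_ne_zero.2 hS0)).trans hTS'
    · exact (natDegree_coeff_le_totalDegree_sub S n).trans (by omega)
  -- one factor vanishes on `a₀` to precision `Y^κ`
  have hev : χ₀.eval a₀ = P.eval a₀ * Q.eval a₀ := by rw [hPQ, eval_mul]
  rw [hev] at hroot
  rcases X_pow_dvd_or_of_X_pow_two_mul_dvd_mul hroot with hPa | hQa
  · obtain ⟨h1, h2⟩ := hsmall hP0 (by omega)
    exact hP0 (hinj P h1 h2 hPa)
  · obtain ⟨h1, h2⟩ := hsmall hQ0 (by omega)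
    exact hQ0 (hinj Q h1 h2 hQa)

end Literature.NumberTheory.DiophantineGeometry
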